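import Summits.PneNP.PneNP.Theorems.KarlinRubinMonotoneBlindPi3Count
import Summits.PneNP.PneNP.Theorems.KarlinRubinMonotoneBlindStubBlindAndDnfBound

/-!
# Route KarlinRubin, crux `MonotoneBlind` (stmt-PneNP-18027): AND of narrow DNFs — the planted bound per `n`

Stage B of the AC⁰ line (seat write-up `MonotoneBlind_AC0_announce.md`), probability form of `andDnf_flag_count`:
for `f = ⋀_i D_i` with `m` monotone DNFs of `≤ M` terms, each term of `≤ L` slots, and parameters `2 ≤ k ≤ n₁ ≤ n`,
`0 < v₀ ≤ n₁`, `r = C(v₀-1,2)`,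

  `Pr_{G(n,1/2,k)}[f] ≤ Pr_{G(n,1/2)}[f] + m · (2^{2r} (2(L+1)^{2r})^{r+1} + M · C(2L,v₀)) · n₁^{v₀} / n^{v₀} + r k² / n₁²`

(`andNarrowDnf_planted_le`): one clique-restriction switching step at the sub-universe size `n₁` (gain
`C(n-v₀,n₁-v₀)/C(n,n₁) ≤ (n₁/n)^{v₀}`) followed by the narrow-CNF revival bound (`C(n₁-2,k-2)/C(n₁,k) ≤ (k/n₁)²`).
Also the two ratio inequalities (`choose_sub_mul_pow_le`) and the `ℕ → ℝ≥0∞` transfer (`natCast_div_le_div_of_mul_le`).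

All `--supports stmt-PneNP-18027`; no definitions.
-/

set_option linter.dupNamespace false -- `Summit.PneNP.PneNP.…`: summit = sub-problem (D-0017)

namespace Summit.PneNP.PneNP.Theorems

open Finset
open scoped ENNReal
open Literature.Computability.Complexity
open Literature.Probability.RandomGraphs.PlantedClique

open MonotoneBlind.VertexCover (natCast_div_le_div_of_mul_le)

variable {n : ℕ}

/-! ### Ratios of binomial coefficients -/

/-- `C(a-u, b-u) · a^u ≤ C(a, b) · b^u` for `u ≤ b ≤ a`: the probability that a uniform `b`-subset of an `a`-set contains
`u` given points is at most `(b/a)^u`. [folklore] -/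
theorem choose_sub_mul_pow_le (a b u : ℕ) (hu : u ≤ b) (hb : b ≤ a) :
    (a - u).choose (b - u) * a ^ u ≤ a.choose b * b ^ u := by
  induction u with
  | zero => simp
  | succ u ih =>
    have hu' : u ≤ b := Nat.le_of_succ_le hu
    have hau : 0 < a - u := by omega
    -- `(a-u) C(a-u-1, b-u-1) = (b-u) C(a-u, b-u)`
    have hid : (a - u) * (a - (u + 1)).choose (b - (u + 1)) = (b - u) * (a - u).choose (b - u) := by
      have h := Nat.add_one_mul_choose_eq (a - (u + 1)) (b - (u + 1))
      have h1 : a - (u + 1) + 1 = a - u := by omega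
      have h2 : b - (u + 1) + 1 = b - u := by omega
      rw [h1, h2] at h
      rw [h, mul_comm]
    -- cancel `a - u`
    refine Nat.le_of_mul_le_mul_left ?_ hau
    calc (a - u) * ((a - (u + 1)).choose (b - (u + 1)) * a ^ (u + 1))
        = (b - u) * ((a - u).choose (b - u) * a ^ u) * a := by rw [← mul_assoc, hid]; ring
      _ ≤ (b - u) * (a.choose b * b ^ u) * a := Nat.mul_le_mul_right _ (Nat.mul_le_mul_left _ (ih hu'))
      _ = ((b - u) * a) * (a.choose b * b ^ u) := by ring
      _ ≤ (b * (a - u)) * (a.choose b * b ^ u) := by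
          refine Nat.mul_le_mul_right _ ?_
          -- `(b-u) a ≤ b (a-u)` since `u b ≤ u a`
          have h1 : (b - u) * a + u * a = b * a := by rw [← add_mul, Nat.sub_add_cancel hu']
          have h2 : b * (a - u) + b * u = b * a := by rw [← mul_add, Nat.sub_add_cancel (hu'.trans hb)]
          have h3 : u * b ≤ u * a := Nat.mul_le_mul_left _ hb
          nlinarith
      _ = (a - u) * (a.choose b * b ^ (u + 1)) := by ring

/-! ### The planted bound for an AND of narrow DNFs -/

open Classical in
/-- **Planted bound for an AND of narrow DNFs (per `n`).** For `f = ⋀_i D_i` (`m` monotone DNFs with `≤ M` terms, every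
term of `≤ L` slots) and `2 ≤ k ≤ n₁ ≤ n`, `0 < v₀ ≤ n₁`, `r = C(v₀-1,2)`:
`Pr_{G(n,1/2,k)}[f] ≤ Pr_{G(n,1/2)}[f] + m (2^{2r} (2(L+1)^{2r})^{r+1} + M C(2L,v₀)) n₁^{v₀} / n^{v₀} + r k² / n₁²`.
[cite: Beame1994, §3] -/
theorem andNarrowDnf_planted_le (hn : 0 < n) {k n₁ L v₀ m M : ℕ} (hk2 : 2 ≤ k) (hk : k ≤ n₁) (hn₁ : n₁ ≤ n)
    (hv₀ : 0 < v₀) (hv₀' : v₀ ≤ n₁)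
    (𝓓 : Fin m → Finset (Finset (⊤ : SimpleGraph (Fin n)).edgeSet)) (hM : ∀ i, #(𝓓 i) ≤ M)
    (hL : ∀ i, ∀ T ∈ 𝓓 i, #T ≤ L) :
    (plantedCliqueDist n k).toOuterMeasure {x | ∀ i, ∃ T ∈ 𝓓 i, ∀ e ∈ T, x e = true} ≤
      (erdosRenyiHalf n).toOuterMeasure {x | ∀ i, ∃ T ∈ 𝓓 i, ∀ e ∈ T, x e = true} +
        ((m * (2 ^ ((v₀ - 1).choose 2 + (v₀ - 1).choose 2) *
            (2 * (L + 1) ^ (2 * (v₀ - 1).choose 2)) ^ ((v₀ - 1).choose 2 + 1) + M * (2 * L).choose v₀) *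
          n₁ ^ v₀ : ℕ) : ℝ≥0∞) / ((n ^ v₀ : ℕ) : ℝ≥0∞) +
        (((v₀ - 1).choose 2 * k ^ 2 : ℕ) : ℝ≥0∞) / ((n₁ ^ 2 : ℕ) : ℝ≥0∞) := by
  set r := (v₀ - 1).choose 2 with hr
  set T := 2 ^ (r + r) * (2 * (L + 1) ^ (2 * r)) ^ (r + 1) + M * (2 * L).choose v₀ with hT
  set N := Fintype.card (⊤ : SimpleGraph (Fin n)).edgeSet with hN
  set f : EdgeVec n → Prop := fun x => ∀ i, ∃ T ∈ 𝓓 i, ∀ e ∈ T, x e = true with hf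
  have hkn : k ≤ n := hk.trans hn₁
  have hKS : kSubsets n k = powersetCard k (univ : Finset (Fin n)) := by rw [kSubsets, min_eq_left hkn]
  -- the count
  have hcount := andDnf_flag_count k n₁ L v₀ hk hv₀ 𝓓 hM hL
  rw [← hr, ← hN] at hcount
  -- positivity of the denominators
  have hD₁ : 0 < (n - k).choose (n₁ - k) := Nat.choose_pos (by omega)
  have hCnk : 0 < n.choose k := Nat.choose_pos hkn
  have hCnn₁ : 0 < n.choose n₁ := Nat.choose_pos hn₁
  have hCn₁k : 0 < n₁.choose k := Nat.choose_pos hk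
  have hflag : n.choose k * (n - k).choose (n₁ - k) = n.choose n₁ * n₁.choose k := (Nat.choose_mul (n := n) hk).symm
  have hcardE : Fintype.card (EdgeVec n) = 2 ^ N := by simp [EdgeVec, hN]
  -- rewrite the two measures as counts
  rw [plantedCliqueDist_toOuterMeasure_eq_sum, hKS, card_powersetCard, card_univ, Fintype.card_fin]
  simp only [erdosRenyiHalf_toOuterMeasure_eq_card_div, hcardE]
  have hcardA : ∀ A : Finset (Fin n),
      #(univ.filter fun x : EdgeVec n => x ∈ {x | plant A x ∈ {x : EdgeVec n | f x}}) =
        #(univ.filter fun x : EdgeVec n => f (plant A x)) := fun A =>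
    congrArg Finset.card (by ext x; simp)
  have hcardF : #(univ.filter fun x : EdgeVec n => x ∈ {x : EdgeVec n | f x}) =
      #(univ.filter fun x : EdgeVec n => f x) := congrArg Finset.card (by ext x; simp)
  simp only [hcardA, hcardF]
  -- abbreviations for the numerators
  set Sp := ∑ A ∈ powersetCard k (univ : Finset (Fin n)), #(univ.filter fun x : EdgeVec n => f (plant A x)) with hSp
  set F0 := #(univ.filter fun x : EdgeVec n => f x) with hF0
  have hcount' : (n - k).choose (n₁ - k) * Sp ≤
      n₁.choose k * (m * (2 ^ N * (n - v₀).choose (n₁ - v₀) * T)) + n.choose n₁ * (n₁.choose k * F0) +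
        n.choose n₁ * (2 ^ N * (r * (n₁ - 2).choose (k - 2))) := hcount
  -- `C(n,k)⁻¹ · Σ_A #F_A / 2^N = Sp / (C(n,k) 2^N)`
  have hne1 : ((n.choose k : ℕ) : ℝ≥0∞) ≠ 0 := by exact_mod_cast hCnk.ne'
  have step1 : ((n.choose k : ℕ) : ℝ≥0∞)⁻¹ * ∑ A ∈ powersetCard k (univ : Finset (Fin n)),
      ((#(univ.filter fun x : EdgeVec n => f (plant A x)) : ℕ) : ℝ≥0∞) / ((2 ^ N : ℕ) : ℝ≥0∞) =
      ((Sp : ℕ) : ℝ≥0∞) / (((n.choose k * 2 ^ N : ℕ)) : ℝ≥0∞) := by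
    simp only [div_eq_mul_inv]
    rw [← sum_mul, ← Nat.cast_sum, ← hSp, Nat.cast_mul, ENNReal.mul_inv (Or.inl hne1)
      (Or.inl (ENNReal.natCast_ne_top _))]
    ring
  rw [step1]
  have hden : ((n.choose k * 2 ^ N : ℕ) : ℝ≥0∞) ≠ 0 := by
    have : 0 < n.choose k * 2 ^ N := Nat.mul_pos hCnk (Nat.two_pow_pos N)
    exact_mod_cast this.ne'
  -- the three bounds, each as a ratio of naturals
  have hA : ((n₁.choose k * (m * (2 ^ N * (n - v₀).choose (n₁ - v₀) * T)) : ℕ) : ℝ≥0∞) /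
      ((((n - k).choose (n₁ - k) * (n.choose k * 2 ^ N) : ℕ)) : ℝ≥0∞) ≤
      ((m * T * n₁ ^ v₀ : ℕ) : ℝ≥0∞) / ((n ^ v₀ : ℕ) : ℝ≥0∞) := by
    refine natCast_div_le_div_of_mul_le ?_ (Nat.mul_pos hD₁ (Nat.mul_pos hCnk (Nat.two_pow_pos N))).ne'
      (pow_pos hn _).ne'
    have hch := choose_sub_mul_pow_le n n₁ v₀ hv₀' hn₁
    calc n₁.choose k * (m * (2 ^ N * (n - v₀).choose (n₁ - v₀) * T)) * n ^ v₀
        = m * T * 2 ^ N * n₁.choose k * ((n - v₀).choose (n₁ - v₀) * n ^ v₀) := by ring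
      _ ≤ m * T * 2 ^ N * n₁.choose k * (n.choose n₁ * n₁ ^ v₀) := Nat.mul_le_mul_left _ hch
      _ = m * T * n₁ ^ v₀ * ((n.choose n₁ * n₁.choose k) * 2 ^ N) := by ring
      _ = m * T * n₁ ^ v₀ * ((n - k).choose (n₁ - k) * (n.choose k * 2 ^ N)) := by rw [← hflag]; ring
  have hB : ((n.choose n₁ * (n₁.choose k * F0) : ℕ) : ℝ≥0∞) /
      ((((n - k).choose (n₁ - k) * (n.choose k * 2 ^ N) : ℕ)) : ℝ≥0∞) ≤
      ((F0 : ℕ) : ℝ≥0∞) / ((2 ^ N : ℕ) : ℝ≥0∞) := by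
    refine natCast_div_le_div_of_mul_le (le_of_eq ?_)
      (Nat.mul_pos hD₁ (Nat.mul_pos hCnk (Nat.two_pow_pos N))).ne' (Nat.two_pow_pos N).ne'
    calc n.choose n₁ * (n₁.choose k * F0) * 2 ^ N = F0 * ((n.choose n₁ * n₁.choose k) * 2 ^ N) := by ring
      _ = F0 * ((n - k).choose (n₁ - k) * (n.choose k * 2 ^ N)) := by rw [← hflag]; ring
  have hC : ((n.choose n₁ * (2 ^ N * (r * (n₁ - 2).choose (k - 2))) : ℕ) : ℝ≥0∞) /
      ((((n - k).choose (n₁ - k) * (n.choose k * 2 ^ N) : ℕ)) : ℝ≥0∞) ≤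
      ((r * k ^ 2 : ℕ) : ℝ≥0∞) / ((n₁ ^ 2 : ℕ) : ℝ≥0∞) := by
    refine natCast_div_le_div_of_mul_le ?_ (Nat.mul_pos hD₁ (Nat.mul_pos hCnk (Nat.two_pow_pos N))).ne'
      (pow_pos (by omega) _).ne'
    have hch := choose_sub_mul_pow_le n₁ k 2 hk2 hk
    calc n.choose n₁ * (2 ^ N * (r * (n₁ - 2).choose (k - 2))) * n₁ ^ 2
        = r * 2 ^ N * n.choose n₁ * ((n₁ - 2).choose (k - 2) * n₁ ^ 2) := by ring
      _ ≤ r * 2 ^ N * n.choose n₁ * (n₁.choose k * k ^ 2) := Nat.mul_le_mul_left _ hch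
      _ = r * k ^ 2 * ((n.choose n₁ * n₁.choose k) * 2 ^ N) := by ring
      _ = r * k ^ 2 * ((n - k).choose (n₁ - k) * (n.choose k * 2 ^ N)) := by rw [← hflag]; ring
  -- assemble
  have hD₁ne : (((n - k).choose (n₁ - k) : ℕ) : ℝ≥0∞) ≠ 0 := by exact_mod_cast hD₁.ne'
  calc ((Sp : ℕ) : ℝ≥0∞) / (((n.choose k * 2 ^ N : ℕ)) : ℝ≥0∞)
      = ((((n - k).choose (n₁ - k) : ℕ) : ℝ≥0∞) * ((Sp : ℕ) : ℝ≥0∞)) /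
          ((((n - k).choose (n₁ - k) : ℕ) : ℝ≥0∞) * (((n.choose k * 2 ^ N : ℕ)) : ℝ≥0∞)) :=
        (ENNReal.mul_div_mul_left _ _ hD₁ne (ENNReal.natCast_ne_top _)).symm
    _ = ((((n - k).choose (n₁ - k) * Sp : ℕ)) : ℝ≥0∞) /
          ((((n - k).choose (n₁ - k) * (n.choose k * 2 ^ N) : ℕ)) : ℝ≥0∞) := by
        push_cast; ring_nf
    _ ≤ (((n₁.choose k * (m * (2 ^ N * (n - v₀).choose (n₁ - v₀) * T)) + n.choose n₁ * (n₁.choose k * F0) +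
          n.choose n₁ * (2 ^ N * (r * (n₁ - 2).choose (k - 2))) : ℕ)) : ℝ≥0∞) /
          ((((n - k).choose (n₁ - k) * (n.choose k * 2 ^ N) : ℕ)) : ℝ≥0∞) :=
        ENNReal.div_le_div_right (by exact_mod_cast hcount') _
    _ = ((n₁.choose k * (m * (2 ^ N * (n - v₀).choose (n₁ - v₀) * T)) : ℕ) : ℝ≥0∞) /
            ((((n - k).choose (n₁ - k) * (n.choose k * 2 ^ N) : ℕ)) : ℝ≥0∞) +
          ((n.choose n₁ * (n₁.choose k * F0) : ℕ) : ℝ≥0∞) /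
            ((((n - k).choose (n₁ - k) * (n.choose k * 2 ^ N) : ℕ)) : ℝ≥0∞) +
          ((n.choose n₁ * (2 ^ N * (r * (n₁ - 2).choose (k - 2))) : ℕ) : ℝ≥0∞) /
            ((((n - k).choose (n₁ - k) * (n.choose k * 2 ^ N) : ℕ)) : ℝ≥0∞) := by
        rw [Nat.cast_add, Nat.cast_add, ENNReal.add_div, ENNReal.add_div]
    _ ≤ ((m * T * n₁ ^ v₀ : ℕ) : ℝ≥0∞) / ((n ^ v₀ : ℕ) : ℝ≥0∞) + ((F0 : ℕ) : ℝ≥0∞) / ((2 ^ N : ℕ) : ℝ≥0∞) +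
          ((r * k ^ 2 : ℕ) : ℝ≥0∞) / ((n₁ ^ 2 : ℕ) : ℝ≥0∞) := add_le_add (add_le_add hA hB) hC
    _ = _ := by rw [hT]; try ring

/-- Registered stub `stub_pi3Planted` of the AC⁰ line, stage B (the binomial ratio inequality). [folklore] -/
theorem stub_pi3Planted :
    ∀ a b u : ℕ, u ≤ b → b ≤ a → (a - u).choose (b - u) * a ^ u ≤ a.choose b * b ^ u :=
  fun a b u hu hb => choose_sub_mul_pow_le a b u hu hb

end Summit.PneNP.PneNP.Theorems
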